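import Literature.NumberTheory.EllipticCurves.Rank1Residual.Typed.CasselsLowerBound
import Literature.NumberTheory.EllipticCurves.Rank1Residual.Typed.X2
import HarnessLib

/-!
# Class X2 ∧ analytic rank `0`: the typed input discharged per curve by a Cassels certificate
(cell `b2b-bsdres`, literature seat gen 10)

HONEST FRAMING (run/shared/lean/b2b/bsd-rank1-residual/): this cell deletes COMBINATION-shaped
residual classes from PUBLISHED theorems only; the CONSTRUCTION-shaped classes — X2 among them — are
TYPED, not attempted; this is not "finishing BSD". Nothing here is a class theorem: it is the X2
instance of the class-free rank-`0` certificate lever of `Typed/CasselsLowerBound.lean`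
(`bsdp_of_wuthrich_of_casselsTate_of_dvd`: Wuthrich 2014 Prop. 21 upper bound at an odd prime of
good or multiplicative reduction with surjective-or-Borel image + Cassels–Tate squareness + the
finite certificate `p ∣ #Ш(E/ℚ)` ⇒ `BSD(E,p)` when `ord_p #Ш_an ≤ 2`), stated with the class
predicate `ClassX2 W p := p ≠ 2 ∧ Red W p ∧ Mult W p` (multiplicative ⇒ not additive; reducible ⇒
Borel image), exactly as `X11ThreeRankZero.bsdp_of_casselsTate_of_three_dvd` does for X11 at `3`.

Census use (`HOME/b2b-bsdres-lit/g10/desc3phi/CERT-X2-RANK0-P3-DESC3GEN-LIT.md`): among the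
rank-`0` X2 pairs at `p = 3` with `N < 2·10⁴`, every isogeny class but two has a member `E′` with
`3 ∤ #Ш_an(E′)` (Prop. 21 + isogeny invariance); the two remaining classes `5568g`, `19776h`
(`#Ш_an = 9` on both members, no rational `3`-torsion point) carry a `3`-isogeny-descent
certificate `Ш(E)[3] ≠ 0` on each of their four curves (one engine; a second is owed before the
lane books a row). The certificate enters only through the hypothesis `hdvd : p ∣ #Ш(E/ℚ)`
(`dvd_shaOrder_of_exists_torsion`).

References: Wuthrich 2014 Prop. 21 (p. 400) [Wuthrich2014]; Silverman AEC Thm. X.4.14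
(Cassels–Tate) [SilvermanAEC2009]; Miller 2011 §1, Def. 1.1 [Miller2011LMS]; GZK = bsd.S17;
modularity = bsd.S1.
-/

noncomputable section

open scoped Classical

open WeierstrassCurve Literature.NumberTheory.EllipticCurves
  Literature.NumberTheory.EllipticCurves.Rank1Residual
  Literature.NumberTheory.EllipticCurves.Wuthrich2014

namespace Literature.NumberTheory.EllipticCurves.Rank1Residual.Typed

variable (W : WeierstrassCurve ℚ) [W.IsElliptic] (p : ℕ) [Fact p.Prime]

/-- **X2 ∧ `r_an = 0`: the typed missing input HOLDS at `(E,p)` given the finite certificate.** If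
`ord_{s=1} L(E,s) = 0`, `#Ш(E/ℚ)_an` is a rational `q` with `ord_p q ≤ 2`, and `p ∣ #Ш(E/ℚ)`, then
`X2.MissingInputAt W p` of `Typed/X2.lean` holds: its rank-`0` conjunct (the lower bound
`ord_p #Ш_an ≤ ord_p #Ш`) by Cassels–Tate squareness (`hCT`) via
`missingLowerBoundAt_of_casselsTate_of_pow_dvd` (with `Ш` finite by Gross–Zagier–Kolyvagin `hGZK`),
its rank-`1` conjunct vacuously. Per curve; NOT a class statement.
[cite: SilvermanAEC2009, Thm. X.4.14] [cite: Miller2011LMS, Def. 1.1] -/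
theorem X2.missingInputAt_of_casselsTate_of_dvd (hCT : exists_casselsTate_pairing (K := ℚ))
    (hGZK : rank_eq_analyticRank_of_analyticRank_le_one) (hr : W.analyticRank = 0)
    {q : ℚ} (hq : shaAn W = (q : ℂ)) (hv : padicValRat p q ≤ 2) (hdvd : p ∣ W.shaOrder) :
    X2.MissingInputAt W p :=
  ⟨fun _ => missingLowerBoundAt_of_casselsTate_of_pow_dvd W p hCT (hGZK W (by omega)).2 hq
      (k := 1) (by simpa using hv) (by simpa using hdvd),
    fun h1 => absurd h1 (by omega)⟩

variable [W.IsGloballyMinimal]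

/-- **X2 ∧ `r_an = 0` with `ord_p #Ш_an ≤ 2`: `BSD(E,p)` from PUBLISHED theorems plus the finite
certificate `p ∣ #Ш(E/ℚ)`.** For a globally minimal `E/ℚ` with `ord_{s=1} L(E,s) = 0` and `(E,p)`
in class X2 (`p` odd, `E[p]` reducible, multiplicative reduction at `p` — hence not additive and
Borel image, the hypotheses of Wuthrich's Prop. 21 `hW`), `#Ш(E/ℚ)_an = q` with `ord_p q ≤ 2`, and
`p ∣ #Ш(E/ℚ)` (e.g. `Ш(E/ℚ)[p] ≠ 0` from a `p`-isogeny descent, `dvd_shaOrder_of_exists_torsion`):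
Miller's `BSD(E,p)`. Inputs: Prop. 21 (`hW`), Cassels–Tate (`hCT`), Gross–Zagier–Kolyvagin
(`hGZK`), modularity (`hmod`) — all published; the certificate is per curve. Census candidates at
`p = 3`: `5568g1, 5568g2, 19776h1, 19776h2` (`#Ш_an = 9`). SUB-class statement; X2 stays typed.
[cite: Wuthrich2014, Prop. 21 (p. 400)] [cite: SilvermanAEC2009, Thm. X.4.14]
[cite: Miller2011LMS, §1 and Def. 1.1] -/
theorem X2.bsdp_of_casselsTate_of_dvd (hCT : exists_casselsTate_pairing (K := ℚ))
    (hW : sha_dvd_analyticSha) (hGZK : rank_eq_analyticRank_of_analyticRank_le_one)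
    (hmod : hasEntireLFunction_rat) (hr : W.analyticRank = 0) (hX : ClassX2 W p)
    {q : ℚ} (hq : shaAn W = (q : ℂ)) (hv : padicValRat p q ≤ 2) (hdvd : p ∣ W.shaOrder) :
    BSDp W p :=
  X2.bsdp_of_missingInputAt hW hGZK hmod W p (by omega) hX
    (X2.missingInputAt_of_casselsTate_of_dvd W p hCT hGZK hr hq hv hdvd)

/-- The same with the certificate in the shape a descent delivers: a nonzero element of
`Ш(E/ℚ)` killed by `p`. [cite: Wuthrich2014, Prop. 21 (p. 400)]
[cite: SilvermanAEC2009, Thm. X.4.14] [cite: Miller2011LMS, §1 and Def. 1.1] -/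
theorem X2.bsdp_of_casselsTate_of_exists_torsion (hCT : exists_casselsTate_pairing (K := ℚ))
    (hW : sha_dvd_analyticSha) (hGZK : rank_eq_analyticRank_of_analyticRank_le_one)
    (hmod : hasEntireLFunction_rat) (hr : W.analyticRank = 0) (hX : ClassX2 W p)
    {q : ℚ} (hq : shaAn W = (q : ℂ)) (hv : padicValRat p q ≤ 2)
    (hsha : ∃ x : W.sha, x ≠ 0 ∧ p • x = 0) : BSDp W p :=
  X2.bsdp_of_casselsTate_of_dvd W p hCT hW hGZK hmod hr hX hq hv
    (dvd_shaOrder_of_exists_torsion W p hsha)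

end Literature.NumberTheory.EllipticCurves.Rank1Residual.Typed
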